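import Summits.NavierStokesRegularity.FunctionalMining.StretchingWrapCases
import HarnessLib

/-!
# K1-Q1, the wrap identity bound (bank blueprint N1) — part 3: Lemma D and `WrapIdentityBound`

Cell `pub-nsfunc`, prove seat gen 5, on `WRAP-KERNEL-BLUEPRINT.md` §2–§3 / dictionary node `WrapIdentityBound`.
**Search for candidate a priori estimates; no regularity claim.** Static field facts only;
nothing is asserted about Navier–Stokes solutions or their regularity.

This part: (§8) Lemma D — `∫_{T³}` of functions of `(x₁, x₂)` reduces to `T²` (`tailProj`), and
`∫_{T²} a(y₀+y₁)b(y₀−y₁) = (∫a)(∫b)` (translation invariance, Fubini, invariance under `y ↦ 2•y`); hence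
`∫Q̃'(x₁±x₂)² = ∫₀¹Q̃'²` and `∫Q̃'(x₁+x₂)Q̃'(x₁−x₂) = (∫₀¹Q̃')² = 0`; (§9) for the glued field:
`σ(u) = 2κ(T₁₁−T₂₂)(u₊) − 2κ(T₁₁−T₂₂)(u₋) + σ(u₊) + σ(u₋)`, `ℰ(u) = 4κ²∫₀¹Q̃'² + ℰ(u₊) + ℰ(u₋)`, `|ω(u)|² ≤ 1`,
and the headline **`wrapIdentityBound_holds : WrapIdentityBound`** (`κ = Λ/2`, `ε = δ/2`). With the dictionary's
kernel-proved assemblies (`oneSided_le_stretchingSupConst_of_wrapIdentity`, `nestedLowerBound_of_wrapIdentity`) the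
kernel obligations for `(4+3√2)/16 ≤ C⋆`, `C_{2.5D} < C⋆` and `(2+√5)/8 ≤ C⋆` are now exactly `ConfinedPlus` /
`ConfinedMinus` (nodes N2–N4).
-/

noncomputable section

open MeasureTheory Set Filter Topology Function
open scoped InnerProductSpace ContDiff

namespace Summit.NavierStokesRegularity.FunctionalMining

open Literature.Analysis Literature.Analysis.FunctionSpaces Literature.Analysis.FunctionSpaces.Torus
open Literature.Analysis.FluidPDE Literature.Analysis.FluidPDE.Torus

namespace WrapStretching

open CellularStretching

/-! ## 8. Lemma D: integrals of functions of `x₁ ± x₂` over `T³` -/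

/-- The projection `T³ → T²` onto the coordinates `(x₁, x₂)`. [ours; bookkeeping] -/
def tailProj (x : UnitAddTorus (Fin 3)) : UnitAddTorus (Fin 2) := fun j => x j.succ

/-- `tailProj` preserves Haar measure (`T³ = T¹ × T²` at the first coordinate, second projection). [folklore] -/
theorem measurePreserving_tailProj : MeasurePreserving tailProj volume volume := by
  have h1 := measurePreserving_piFinSuccAbove (fun _ : Fin 3 => (volume : Measure UnitAddCircle)) 0
  have h2 : MeasurePreserving (Prod.snd : UnitAddCircle × (Fin 2 → UnitAddCircle) → _)
      ((volume : Measure UnitAddCircle).prod (Measure.pi fun _ : Fin 2 => volume))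
      (Measure.pi fun _ : Fin 2 => volume) := measurePreserving_snd
  have h3 := h2.comp h1
  have hfun : (Prod.snd ∘ (MeasurableEquiv.piFinSuccAbove (fun _ : Fin 3 => UnitAddCircle) 0)) = tailProj := by
    funext x; funext j
    change x ((0 : Fin 3).succAbove j) = x j.succ
    rw [Fin.succAbove_zero]
  rw [hfun] at h3
  simpa [MeasureTheory.volume_pi] using h3

/-- `∫_{T³} F(x₁, x₂) dx = ∫_{T²} F`. [folklore] -/
theorem integral_comp_tailProj {F : UnitAddTorus (Fin 2) → ℝ} (hF : AEStronglyMeasurable F volume) :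
    ∫ x, F (tailProj x) = ∫ y, F y := by
  have h := integral_map (μ := (volume : Measure (UnitAddTorus (Fin 3)))) (φ := tailProj) (f := F)
    measurePreserving_tailProj.measurable.aemeasurable
    (by rw [measurePreserving_tailProj.map_eq]; exact hF)
  rw [measurePreserving_tailProj.map_eq] at h
  exact h.symm

/-- **Lemma D on `T²`**: `∫ a(y₀ + y₁) b(y₀ − y₁) dy = (∫a)(∫b)` (translation invariance in `y₀`, Fubini, and
invariance of Haar measure under `y ↦ 2•y`). [folklore] -/
theorem integral_mul_add_sub {a b : UnitAddCircle → ℝ} (ha : Continuous a) (hb : Continuous b) :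
    ∫ y : UnitAddTorus (Fin 2), a (y 0 + y 1) * b (y 0 - y 1) = (∫ c, a c) * (∫ c, b c) := by
  have hmp := MeasureTheory.volume_preserving_finTwoArrow UnitAddCircle
  have h1 : ∫ y : UnitAddTorus (Fin 2), a (y 0 + y 1) * b (y 0 - y 1) =
      ∫ p : UnitAddCircle × UnitAddCircle, a (p.1 + p.2) * b (p.1 - p.2) := by
    rw [← hmp.integral_comp']; rfl
  have hcont : Continuous fun p : UnitAddCircle × UnitAddCircle => a (p.1 + p.2) * b (p.1 - p.2) :=
    (ha.comp (continuous_fst.add continuous_snd)).mul (hb.comp (continuous_fst.sub continuous_snd))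
  rw [h1, MeasureTheory.Measure.volume_eq_prod, integral_prod_symm _
    (hcont.integrable_of_hasCompactSupport (HasCompactSupport.of_compactSpace _))]
  -- inner integral: translate `p₁ ↦ z + p₂`
  have hinner : ∀ p₂ : UnitAddCircle, ∫ p₁, a (p₁ + p₂) * b (p₁ - p₂) = ∫ z, a (z + 2 • p₂) * b z := by
    intro p₂
    rw [← integral_add_right_eq_self (fun p₁ => a (p₁ + p₂) * b (p₁ - p₂)) p₂]
    refine integral_congr_ae (ae_of_all _ fun z => ?_)
    simp only [add_sub_cancel_right, two_nsmul, add_assoc]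
  simp_rw [hinner]
  -- swap the order of integration
  have hcont2 : Continuous fun q : UnitAddCircle × UnitAddCircle => a (q.2 + 2 • q.1) * b q.2 :=
    (ha.comp (continuous_snd.add ((continuous_nsmul 2).comp continuous_fst))).mul (hb.comp continuous_snd)
  have hsw := integral_integral_swap (μ := (volume : Measure UnitAddCircle)) (ν := (volume : Measure UnitAddCircle))
    (f := fun p₂ z => a (z + 2 • p₂) * b z)
    (hcont2.integrable_of_hasCompactSupport (HasCompactSupport.of_compactSpace _))
  rw [hsw]
  have hz : ∀ z : UnitAddCircle, ∫ p₂, a (z + 2 • p₂) * b z = (∫ c, a c) * b z := by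
    intro z
    rw [integral_mul_const, integral_comp_nsmul_circle (g := fun w => a (z + w)) (ha.comp (continuous_const.add continuous_id))
      (by norm_num : 0 < 2), integral_add_left_eq_self]
  simp_rw [hz]
  rw [integral_const_mul]

/-- `∫_{T³} Q'(x₁+x₂)² = ∫₀¹ Q'²`. [ours; elementary] -/
theorem integral_sq_add (Q : ShearProfile) :
    ∫ x : UnitAddTorus (Fin 3), Q.D.onCircle (x 1 + x 2) ^ 2 = msqD Q := by
  have h : ∫ x : UnitAddTorus (Fin 3), Q.D.onCircle (x 1 + x 2) ^ 2 =
      ∫ y : UnitAddTorus (Fin 2), Q.D.onCircle (y 0 + y 1) ^ 2 :=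
    integral_comp_tailProj (F := fun y : UnitAddTorus (Fin 2) => Q.D.onCircle (y 0 + y 1) ^ 2)
      ((continuous_onCircle_add Q.D).pow 2).aestronglyMeasurable
  rw [h, integral_comp_add_coord (g := fun c => Q.D.onCircle c ^ 2) (Q.D.continuous_onCircle.pow 2),
    integral_sq_onCircle]
  simp [msqD, ShearProfile.D_apply]

/-- `∫_{T³} Q'(x₁−x₂)² = ∫₀¹ Q'²`. [ours; elementary] -/
theorem integral_sq_sub (Q : ShearProfile) :
    ∫ x : UnitAddTorus (Fin 3), Q.D.onCircle (x 1 - x 2) ^ 2 = msqD Q := by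
  have h : ∫ x : UnitAddTorus (Fin 3), Q.D.onCircle (x 1 - x 2) ^ 2 =
      ∫ y : UnitAddTorus (Fin 2), Q.D.onCircle (y 0 - y 1) ^ 2 :=
    integral_comp_tailProj (F := fun y : UnitAddTorus (Fin 2) => Q.D.onCircle (y 0 - y 1) ^ 2)
      ((continuous_onCircle_sub Q.D).pow 2).aestronglyMeasurable
  rw [h, integral_comp_sub_coord (g := fun c => Q.D.onCircle c ^ 2) (Q.D.continuous_onCircle.pow 2),
    integral_sq_onCircle]
  simp [msqD, ShearProfile.D_apply]

/-- `∫_{T³} Q'(x₁+x₂)Q'(x₁−x₂) = (∫₀¹ Q')²`. [ours; elementary] -/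
theorem integral_mul_add_sub₃ (Q : ShearProfile) :
    ∫ x : UnitAddTorus (Fin 3), Q.D.onCircle (x 1 + x 2) * Q.D.onCircle (x 1 - x 2) =
      (∫ t in (0 : ℝ)..1, deriv Q t) ^ 2 := by
  have h : ∫ x : UnitAddTorus (Fin 3), Q.D.onCircle (x 1 + x 2) * Q.D.onCircle (x 1 - x 2) =
      ∫ y : UnitAddTorus (Fin 2), Q.D.onCircle (y 0 + y 1) * Q.D.onCircle (y 0 - y 1) :=
    integral_comp_tailProj
      (F := fun y : UnitAddTorus (Fin 2) => Q.D.onCircle (y 0 + y 1) * Q.D.onCircle (y 0 - y 1))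
      ((continuous_onCircle_add Q.D).mul (continuous_onCircle_sub Q.D)).aestronglyMeasurable
  rw [h, integral_mul_add_sub Q.D.continuous_onCircle Q.D.continuous_onCircle,
    integral_circle_eq_intervalIntegral, sq]
  simp [ShearProfile.D_apply]

/-! ## 9. Integrated identities for the glued field and the proof of `WrapIdentityBound` -/

section Integrals

variable {κ : ℝ} {Q : ShearProfile} {up um : UnitAddTorus (Fin 3) → EuclideanSpace ℝ (Fin 3)}
variable {ε δ : ℝ} (hε : 0 < ε) (hε' : ε ≤ 1 / 32) (hδε : ε ≤ δ) (hδ : 0 < δ) (hδ' : δ < 1 / 16)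
variable (hp : IsSmooth up) (hm : IsSmooth um) (hdp : IsDivFree up) (hdm : IsDivFree um)
variable (hup : ∀ y ∉ boxPlus (2 * δ), up y = 0) (hum : ∀ y ∉ boxMinus (2 * δ), um y = 0)

include hε hε' hδε hδ hδ' hp hm hup hum in
/-- **Pointwise production density of the glued field.** [ours] -/
theorem prodBC_glue (κ : ℝ) (x : UnitAddTorus (Fin 3)) :
    prodBC (gradAt (glue κ (wprof hε hε') up um) x) =
      2 * κ * (vort (gradAt up x) 1 ^ 2 - vort (gradAt up x) 2 ^ 2) -
        2 * κ * (vort (gradAt um x) 1 ^ 2 - vort (gradAt um x) 2 ^ 2) +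
        prodBC (gradAt up x) + prodBC (gradAt um x) := by
  rw [gradAt_glue κ (wprof hε hε') hp hm x]
  exact (wrap_cases (glue_cases hε hε' hδε hδ hδ' hup hum x)).1

include hε hε' hδε hδ hδ' hp hm hup hum in
/-- **Pointwise vorticity of the glued field.** [ours] -/
theorem vortSq_glue (κ : ℝ) (x : UnitAddTorus (Fin 3)) :
    ∑ i, vort (gradAt (glue κ (wprof hε hε') up um) x) i ^ 2 =
      4 * κ ^ 2 * ((wprof hε hε').D.onCircle (x 1 - x 2) - (wprof hε hε').D.onCircle (x 1 + x 2)) ^ 2 +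
        ∑ i, vort (gradAt up x) i ^ 2 + ∑ i, vort (gradAt um x) i ^ 2 := by
  rw [gradAt_glue κ (wprof hε hε') hp hm x]
  exact (wrap_cases (glue_cases hε hε' hδε hδ hδ' hup hum x)).2

include hε hε' hδε hδ hδ' hp hm hup hum in
/-- **`|ω(u)|² ≤ 1` pointwise** when `16κ² ≤ 1` and `|ω(u±)|² ≤ 1`. [ours] -/
theorem torusVorticitySqAt_glue_le {κ : ℝ} (hκ : 16 * κ ^ 2 ≤ 1) (hωp : ∀ x, torusVorticitySqAt up x ≤ 1)
    (hωm : ∀ x, torusVorticitySqAt um x ≤ 1) (x : UnitAddTorus (Fin 3)) :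
    torusVorticitySqAt (glue κ (wprof hε hε') up um) x ≤ 1 := by
  rw [torusVorticitySqAt_eq_sum_sq, vorticityComp_eq_vort, gradAt_glue κ (wprof hε hε') hp hm x]
  have h1 := hωp x; have h2 := hωm x
  rw [torusVorticitySqAt_eq_sum_sq, vorticityComp_eq_vort] at h1 h2
  exact wrap_vort_le_one (glue_cases hε hε' hδε hδ hδ' hup hum x) (abs_wprofD_le hε hε' _)
    (abs_wprofD_le hε hε' _) hκ h1 h2

include hε hε' hδε hδ hδ' hp hm hdp hdm hup hum in
/-- **The production of the glued field**:
`σ(u) = 2κ(T₁₁−T₂₂)(u₊) − 2κ(T₁₁−T₂₂)(u₋) + σ(u₊) + σ(u₋)`. [ours] -/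
theorem enstrophyProduction_glue (κ : ℝ) :
    enstrophyProduction (glue κ (wprof hε hε') up um) =
      2 * κ * (vorticityMoment up 1 1 - vorticityMoment up 2 2) -
        2 * κ * (vorticityMoment um 1 1 - vorticityMoment um 2 2) +
        enstrophyProduction up + enstrophyProduction um := by
  have hu := isSmooth_glue κ (wprof hε hε') hp hm
  have hdu := isDivFree_glue κ (wprof hε hε') hp hm hdp hdm
  rw [enstrophyProduction_eq_integral_prodBC hu hdu]
  simp_rw [prodBC_glue hε hε' hδε hδ hδ' hp hm hup hum κ]
  have iP1 : Integrable (fun x => vort (gradAt up x) 1 ^ 2) volume := ((continuous_vort_gradAt hp 1).pow 2).integrable_unitAddTorus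
  have iP2 : Integrable (fun x => vort (gradAt up x) 2 ^ 2) volume := ((continuous_vort_gradAt hp 2).pow 2).integrable_unitAddTorus
  have iM1 : Integrable (fun x => vort (gradAt um x) 1 ^ 2) volume := ((continuous_vort_gradAt hm 1).pow 2).integrable_unitAddTorus
  have iM2 : Integrable (fun x => vort (gradAt um x) 2 ^ 2) volume := ((continuous_vort_gradAt hm 2).pow 2).integrable_unitAddTorus
  have iBP : Integrable (fun x => prodBC (gradAt up x)) volume := (continuous_prodBC_gradAt hp).integrable_unitAddTorus
  have iBM : Integrable (fun x => prodBC (gradAt um x)) volume := (continuous_prodBC_gradAt hm).integrable_unitAddTorus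
  have iA : Integrable (fun x => 2 * κ * (vort (gradAt up x) 1 ^ 2 - vort (gradAt up x) 2 ^ 2)) volume :=
    (iP1.sub iP2).const_mul _
  have iB : Integrable (fun x => 2 * κ * (vort (gradAt um x) 1 ^ 2 - vort (gradAt um x) 2 ^ 2)) volume :=
    (iM1.sub iM2).const_mul _
  have iAB : Integrable (fun x => 2 * κ * (vort (gradAt up x) 1 ^ 2 - vort (gradAt up x) 2 ^ 2) -
      2 * κ * (vort (gradAt um x) 1 ^ 2 - vort (gradAt um x) 2 ^ 2)) volume := iA.sub iB
  have iABP : Integrable (fun x => 2 * κ * (vort (gradAt up x) 1 ^ 2 - vort (gradAt up x) 2 ^ 2) -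
      2 * κ * (vort (gradAt um x) 1 ^ 2 - vort (gradAt um x) 2 ^ 2) + prodBC (gradAt up x)) volume := iAB.add iBP
  rw [integral_add iABP iBM, integral_add iAB iBP, integral_sub iA iB,
    integral_const_mul, integral_const_mul, integral_sub iP1 iP2, integral_sub iM1 iM2,
    ← vorticityMoment_eq, ← vorticityMoment_eq, ← vorticityMoment_eq, ← vorticityMoment_eq,
    ← enstrophyProduction_eq_integral_prodBC hp hdp, ← enstrophyProduction_eq_integral_prodBC hm hdm]

include hε hε' in
/-- **The outer vorticity integral**: `∫_{T³} 4κ²(Q̃'(x₁−x₂) − Q̃'(x₁+x₂))² = 8κ²∫₀¹Q̃'²` (Lemma D and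
`∫₀¹ Q̃' = 0`). [ours; elementary] -/
theorem integral_outer_vortSq (κ : ℝ) :
    ∫ x : UnitAddTorus (Fin 3),
        4 * κ ^ 2 * ((wprof hε hε').D.onCircle (x 1 - x 2) - (wprof hε hε').D.onCircle (x 1 + x 2)) ^ 2 =
      8 * κ ^ 2 * msqD (wprof hε hε') := by
  have hA := continuous_onCircle_add₃ (wprof hε hε').D
  have hB := continuous_onCircle_sub₃ (wprof hε hε').D
  have hc1 : Continuous fun x : UnitAddTorus (Fin 3) => (wprof hε hε').D.onCircle (x 1 - x 2) ^ 2 := hB.pow 2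
  have hc2 : Continuous fun x : UnitAddTorus (Fin 3) => (wprof hε hε').D.onCircle (x 1 + x 2) ^ 2 := hA.pow 2
  have hc3 : Continuous fun x : UnitAddTorus (Fin 3) =>
      2 * ((wprof hε hε').D.onCircle (x 1 + x 2) * (wprof hε hε').D.onCircle (x 1 - x 2)) :=
    continuous_const.mul (hA.mul hB)
  have i1 : Integrable (fun x : UnitAddTorus (Fin 3) => (wprof hε hε').D.onCircle (x 1 - x 2) ^ 2) volume :=
    hc1.integrable_unitAddTorus
  have i2 : Integrable (fun x : UnitAddTorus (Fin 3) => (wprof hε hε').D.onCircle (x 1 + x 2) ^ 2) volume :=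
    hc2.integrable_unitAddTorus
  have i12 : Integrable (fun x : UnitAddTorus (Fin 3) => (wprof hε hε').D.onCircle (x 1 - x 2) ^ 2 +
      (wprof hε hε').D.onCircle (x 1 + x 2) ^ 2) volume := i1.add i2
  have i3 : Integrable (fun x : UnitAddTorus (Fin 3) =>
      2 * ((wprof hε hε').D.onCircle (x 1 + x 2) * (wprof hε hε').D.onCircle (x 1 - x 2))) volume :=
    hc3.integrable_unitAddTorus
  have e : ∀ x : UnitAddTorus (Fin 3),
      4 * κ ^ 2 * ((wprof hε hε').D.onCircle (x 1 - x 2) - (wprof hε hε').D.onCircle (x 1 + x 2)) ^ 2 =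
      (4 * κ ^ 2) * ((wprof hε hε').D.onCircle (x 1 - x 2) ^ 2 + (wprof hε hε').D.onCircle (x 1 + x 2) ^ 2 -
        2 * ((wprof hε hε').D.onCircle (x 1 + x 2) * (wprof hε hε').D.onCircle (x 1 - x 2))) := fun x => by ring
  simp_rw [e]
  rw [integral_const_mul, integral_sub i12 i3, integral_add i1 i2, integral_const_mul, integral_sq_sub, integral_sq_add,
    integral_mul_add_sub₃, intervalIntegral_deriv_wprof hε hε']
  ring

include hε hε' hδε hδ hδ' hp hm hdp hdm hup hum in
/-- **The enstrophy of the glued field**: `ℰ(u) = 4κ²∫₀¹Q̃'² + ℰ(u₊) + ℰ(u₋)` (Lemma D; `∫₀¹Q̃' = 0`). [ours] -/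
theorem torusEnstrophy_glue (κ : ℝ) :
    torusEnstrophy (glue κ (wprof hε hε') up um) =
      4 * κ ^ 2 * msqD (wprof hε hε') + torusEnstrophy up + torusEnstrophy um := by
  have hu := isSmooth_glue κ (wprof hε hε') hp hm
  have hdu := isDivFree_glue κ (wprof hε hε') hp hm hdp hdm
  have h2 := two_mul_torusEnstrophy_eq_integral_vort hu hdu
  simp_rw [vortSq_glue hε hε' hδε hδ hδ' hp hm hup hum κ] at h2
  have iW : Integrable (fun x : UnitAddTorus (Fin 3) =>
      4 * κ ^ 2 * ((wprof hε hε').D.onCircle (x 1 - x 2) - (wprof hε hε').D.onCircle (x 1 + x 2)) ^ 2) volume := by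
    have hA := continuous_onCircle_add₃ (wprof hε hε').D
    have hB := continuous_onCircle_sub₃ (wprof hε hε').D
    exact (continuous_const.mul ((hB.sub hA).pow 2)).integrable_unitAddTorus
  have iP : Integrable (fun x => ∑ i, vort (gradAt up x) i ^ 2) volume :=
    (continuous_finsetSum _ fun i _ => (continuous_vort_gradAt hp i).pow 2).integrable_unitAddTorus
  have iM : Integrable (fun x => ∑ i, vort (gradAt um x) i ^ 2) volume :=
    (continuous_finsetSum _ fun i _ => (continuous_vort_gradAt hm i).pow 2).integrable_unitAddTorus
  have iWP : Integrable (fun x : UnitAddTorus (Fin 3) =>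
      4 * κ ^ 2 * ((wprof hε hε').D.onCircle (x 1 - x 2) - (wprof hε hε').D.onCircle (x 1 + x 2)) ^ 2 +
        ∑ i, vort (gradAt up x) i ^ 2) volume := iW.add iP
  rw [integral_add iWP iM, integral_add iW iP, ← two_mul_torusEnstrophy_eq_integral_vort hp hdp,
    ← two_mul_torusEnstrophy_eq_integral_vort hm hdm, integral_outer_vortSq hε hε' κ] at h2
  linarith

include hε hε' hδε hδ hδ' hp hm hdp hdm hup hum in
/-- **The wrap identity bound at the glued field**: if `StretchingSupBound C` with `C ≥ 0`, `16κ² ≤ 1` and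
`|ω(u±)|² ≤ 1`, then `2κ(T₁₁−T₂₂)(u₊) + 2κ(T₂₂−T₁₁)(u₋) + σ(u₊) + σ(u₋) ≤ C(4κ² + ℰ(u₊) + ℰ(u₋))`. [ours] -/
theorem wrap_bound {κ C : ℝ} (hκ : 16 * κ ^ 2 ≤ 1) (hωp : ∀ x, torusVorticitySqAt up x ≤ 1)
    (hωm : ∀ x, torusVorticitySqAt um x ≤ 1) (hC : 0 ≤ C) (hS : StretchingSupBound (d := Fin 3) C) :
    2 * κ * (vorticityMoment up 1 1 - vorticityMoment up 2 2) +
        2 * κ * (vorticityMoment um 2 2 - vorticityMoment um 1 1) +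
        enstrophyProduction up + enstrophyProduction um ≤
      C * (4 * κ ^ 2 + torusEnstrophy up + torusEnstrophy um) := by
  have hu := isSmooth_glue κ (wprof hε hε') hp hm
  have hdu := isDivFree_glue κ (wprof hε hε') hp hm hdp hdm
  have hω : ∀ x, torusVorticitySqAt (glue κ (wprof hε hε') up um) x ≤ (1 : ℝ) ^ 2 := fun x => by
    rw [one_pow]; exact torusVorticitySqAt_glue_le hε hε' hδε hδ hδ' hp hm hup hum hκ hωp hωm x
  have hle := hS (Fintype.card_fin 3) _ hu hdu 1 zero_le_one hω
  rw [enstrophyProduction_glue hε hε' hδε hδ hδ' hp hm hdp hdm hup hum κ,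
    torusEnstrophy_glue hε hε' hδε hδ hδ' hp hm hdp hdm hup hum κ] at hle
  have hμ := msqD_wprof_le hε hε'
  have hμ0 := msqD_nonneg (wprof hε hε')
  have hk2 : 0 ≤ κ ^ 2 := sq_nonneg κ
  have hEp := torusEnstrophy_nonneg up
  have hEm := torusEnstrophy_nonneg um
  nlinarith [mul_le_mul_of_nonneg_left (mul_le_mul_of_nonneg_left hμ hk2) hC]

end Integrals

/-- **N1 of the bank's wrap blueprint holds: `WrapIdentityBound`** (dictionary seat's typed node in
`StretchingWrapIdentity.lean`). For `Λ ∈ (0, ½]`, `δ ∈ (0, 1/16)`, smooth divergence-free `u₊, u₋` vanishing off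
`boxPlus 2δ`, `boxMinus 2δ` with `|ω(u±)|² ≤ 1`, and every `C ≥ 0` with `StretchingSupBound C`:
`Λ(T₁₁−T₂₂)(u₊) + Λ(T₂₂−T₁₁)(u₋) + σ(u₊) + σ(u₋) ≤ C(Λ² + ℰ(u₊) + ℰ(u₋))`. Proof: glue with the diagonal
crossed-shear flow `V₂` (`κ = Λ/2`, plateau profile `Q̃ = S_{δ/2}(· + δ − ¼)`), exact pointwise case analysis,
`σ = ∫ωᵀSω`, `2ℰ = ∫|ω|²`, Lemma D. With the dictionary's kernel-proved assemblies this reduces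
`(4+3√2)/16 ≤ C⋆` / `C_{2.5D} < C⋆` / `(2+√5)/8 ≤ C⋆` to the nodes `ConfinedPlus`/`ConfinedMinus` (N2–N4).
Search for candidate a priori estimates; no regularity claim. [ours] -/
theorem wrapIdentityBound_holds : WrapIdentityBound := by
  intro Λ hΛ hΛ' δ hδ hδ' up um hp hdp hm hdm hup hum hωp hωm C hC hS
  have hε : 0 < δ / 2 := by linarith
  have hε' : δ / 2 ≤ 1 / 32 := by linarith
  have hδε : δ / 2 ≤ δ := by linarith
  have hκ : 16 * (Λ / 2) ^ 2 ≤ 1 := by nlinarith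
  have h := wrap_bound hε hε' hδε hδ hδ' hp hm hdp hdm hup hum (κ := Λ / 2) hκ hωp hωm hC hS
  have e1 : 2 * (Λ / 2) = Λ := by ring
  have e2 : 4 * (Λ / 2) ^ 2 = Λ ^ 2 := by ring
  rw [e1, e2] at h
  exact h

end WrapStretching

end Summit.NavierStokesRegularity.FunctionalMining

end
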